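import Summits.ValiantsHypothesis.ValiantsHypothesis.Theses.TwoAdicLadder
import Literature.Computability.AlgebraicComplexity.DeterminantalIdealComplexityDescent
import Literature.Computability.AlgebraicComplexity.DetInVP

/-!
# TwoAdicLadder, support item `OddPermanentLift` (stmt-ValiantsHypothesis-5950) — PROVED

Route `TwoAdicLadder` of `ValiantsHypothesis`, support item `OddPermanentLift`: if the
odd-permutation polynomial `Q̄_n = Σ_{sign σ = −1} ∏ᵢ x_{i σ(i)}` is p-computable over `𝔽₂` then the
permanent is p-computable over `ℤ/4`.

Proof (the grounder's / refuter's "provable-now" route, BCS 1997 Rem. (21.16)(1)): take an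
optimal fan-in-two `𝔽₂`-circuit for `Q̄_n` and change its constants along the set-theoretic section
`𝔽₂ → ℤ/4`, `a ↦ a.val` (tree `ArithCircuit.mapConsts`; size and fan-in are unchanged); reducing
back mod `2` is a ring homomorphism, so by `ArithCircuit.eval_map_apply` the lifted circuit computes
some `Q'` with `Q' ≡ Q̄_n (mod 2)` coefficientwise, whence `2 Q' = 2 Q̄_n` in `(ℤ/4)[x]`. By the
Leibniz expansions, `per_n − det_n = 2 Q̄_n` over `ℤ/4`; so `per_n = det_n + 2 • Q'` and
`L(per_n) ≤ L(det_n) + L(Q̄_n) + 2`, with `det_n` p-computable over every commutative ring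
(tree `isVPFamily_detPoly_of_commRing`, Berkowitz). Honest framing: a conditional transfer
statement inside a dormant route; its hypothesis (`Q̄_n ∈ VP` over `𝔽₂`) is open; nothing here
bears on VP ≠ VNP.
-/

noncomputable section

open MvPolynomial

-- the summit and the problem share the name `ValiantsHypothesis` (D-0017 single-conjunct layout)
set_option linter.dupNamespace false

namespace Summit.ValiantsHypothesis.ValiantsHypothesis.Theorems.TwoAdicLadder

open Literature.Computability.AlgebraicComplexity

/-- In `ℤ/4`, an element that vanishes mod `2` is killed by `2`. -/
theorem two_mul_eq_zero_of_castHom_eq_zero (a : ZMod 4)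
    (h : ZMod.castHom (show 2 ∣ 4 by norm_num) (ZMod 2) a = 0) : (2 : ZMod 4) * a = 0 := by
  revert a
  decide

/-- A polynomial over `ℤ/4` whose reduction mod `2` vanishes is killed by `2`. -/
theorem two_smul_eq_zero_of_map_castHom_eq_zero {σ : Type*} (R : MvPolynomial σ (ZMod 4))
    (h : MvPolynomial.map (ZMod.castHom (show 2 ∣ 4 by norm_num) (ZMod 2)) R = 0) :
    (2 : ZMod 4) • R = 0 := by
  ext m
  rw [coeff_smul, coeff_zero, smul_eq_mul]
  refine two_mul_eq_zero_of_castHom_eq_zero _ ?_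
  have := congrArg (coeff m) h
  rwa [coeff_map, coeff_zero] at this

/-- The odd-permutation polynomial in the two indexings: `Σ_{odd σ} ∏ᵢ x_{i,σ i} = Σ_{odd σ} ∏ᵢ x_{σ i, i}`
(reindex `σ ↦ σ⁻¹`). -/
theorem oddPerm_sum_eq {R : Type*} [CommRing R] (n : ℕ) :
    (∑ σ ∈ (Finset.univ : Finset (Equiv.Perm (Fin n))).filter (fun σ => Equiv.Perm.sign σ = -1),
        ∏ i : Fin n, (X (i, σ i) : MvPolynomial (Fin n × Fin n) R)) =
      ∑ σ ∈ (Finset.univ : Finset (Equiv.Perm (Fin n))).filter (fun σ => Equiv.Perm.sign σ = -1),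
        ∏ i : Fin n, (X (σ i, i) : MvPolynomial (Fin n × Fin n) R) := by
  classical
  have hprod : ∀ σ : Equiv.Perm (Fin n),
      ∏ i : Fin n, (X (i, σ i) : MvPolynomial (Fin n × Fin n) R) = ∏ i, X (σ⁻¹ i, i) := by
    intro σ
    rw [← Equiv.prod_comp σ (fun j => (X (σ⁻¹ j, j) : MvPolynomial (Fin n × Fin n) R))]
    simp
  simp_rw [hprod]
  rw [Finset.sum_filter, Finset.sum_filter]
  rw [← Equiv.sum_comp (Equiv.inv (Equiv.Perm (Fin n)))
    (fun σ => if Equiv.Perm.sign σ = -1 then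
      ∏ i : Fin n, (X (σ i, i) : MvPolynomial (Fin n × Fin n) R) else 0)]
  refine Finset.sum_congr rfl fun σ _ => ?_
  simp only [Equiv.inv_apply, Equiv.Perm.sign_inv]

/-- **`per_n − det_n = 2 Q̄_n`** (Leibniz expansions; over any commutative ring). -/
theorem perPoly_sub_detPoly_eq (R : Type*) [CommRing R] (n : ℕ) :
    perPoly (Fin n) R - detPoly (Fin n) R =
      (2 : R) • ∑ σ ∈ (Finset.univ : Finset (Equiv.Perm (Fin n))).filter
        (fun σ => Equiv.Perm.sign σ = -1), ∏ i : Fin n, (X (σ i, i) : MvPolynomial (Fin n × Fin n) R) := by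
  classical
  have hper : perPoly (Fin n) R = ∑ σ : Equiv.Perm (Fin n), ∏ i, (X (σ i, i) :
      MvPolynomial (Fin n × Fin n) R) := by
    rw [perPoly, Matrix.permanent]
    rfl
  have hdet : detPoly (Fin n) R = ∑ σ : Equiv.Perm (Fin n),
      Equiv.Perm.sign σ • ∏ i, (X (σ i, i) : MvPolynomial (Fin n × Fin n) R) := by
    rw [detPoly, Matrix.det_apply]
    rfl
  rw [hper, hdet, ← Finset.sum_sub_distrib, Finset.smul_sum, Finset.sum_filter]
  refine Finset.sum_congr rfl fun σ _ => ?_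
  rcases Int.units_eq_one_or (Equiv.Perm.sign σ) with h | h
  · rw [h, one_smul, sub_self, if_neg (by decide)]
  · rw [h, if_pos rfl, Units.smul_def, Units.val_neg, Units.val_one, neg_one_zsmul, sub_neg_eq_add,
      two_smul]

/-- **Item `OddPermanentLift` holds.** -/
theorem oddPermanentLift_proof :
    Summit.ValiantsHypothesis.ValiantsHypothesis.Theses.TwoAdicLadder.OddPermanentLift := by
  unfold Summit.ValiantsHypothesis.ValiantsHypothesis.Theses.TwoAdicLadder.OddPermanentLift
  intro hQ
  classical
  -- notation
  set π : ZMod 4 →+* ZMod 2 := ZMod.castHom (show 2 ∣ 4 by norm_num) (ZMod 2) with hπ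
  set s : ZMod 2 → ZMod 4 := fun a => (a.val : ZMod 4) with hs
  have hπs : ∀ a : ZMod 2, π (s a) = a := by
    intro a
    rw [hs, hπ]
    revert a
    decide
  -- the odd-permutation family over `𝔽₂` and `ℤ/4`
  set Q₂ : (n : ℕ) → MvPolynomial (Fin n × Fin n) (ZMod 2) := fun n =>
    ∑ σ ∈ (Finset.univ : Finset (Equiv.Perm (Fin n))).filter (fun σ => Equiv.Perm.sign σ = -1),
      ∏ i : Fin n, (X (i, σ i) : MvPolynomial (Fin n × Fin n) (ZMod 2)) with hQ₂
  set O₄ : (n : ℕ) → MvPolynomial (Fin n × Fin n) (ZMod 4) := fun n =>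
    ∑ σ ∈ (Finset.univ : Finset (Equiv.Perm (Fin n))).filter (fun σ => Equiv.Perm.sign σ = -1),
      ∏ i : Fin n, (X (i, σ i) : MvPolynomial (Fin n × Fin n) (ZMod 4)) with hO₄
  have hOQ : ∀ n, MvPolynomial.map π (O₄ n) = Q₂ n := by
    intro n
    simp only [hO₄, hQ₂, map_sum, map_prod, map_X]
  -- pointwise bound: `L(per_n) ≤ L(det_n) + (L(Q̄_n) + 1) + 1`
  have hpt : ∀ n, complexity (perPoly (Fin n) (ZMod 4)) ≤
      complexity (detPoly (Fin n) (ZMod 4)) + (complexity (Q₂ n) + 1) + 1 := by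
    intro n
    obtain ⟨P, hP1, hP2, hP3⟩ := ArithCircuit.exists_computes_size_eq_complexity (Q₂ n)
    -- the lifted circuit and its value
    set Q' : MvPolynomial (Fin n × Fin n) (ZMod 4) := (P.mapConsts s).eval with hQ'
    have hmap : (P.mapConsts s).map π = P :=
      ArithCircuit.map_mapConsts_eq_self s π P fun c _ => hπs c
    have hQ'red : MvPolynomial.map π Q' = Q₂ n := by
      rw [hQ', ← ArithCircuit.eval_map_apply, hmap]
      exact hP2
    have hQ'cx : complexity Q' ≤ complexity (Q₂ n) := by
      rw [← hP3, ← ArithCircuit.size_mapConsts s P]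
      exact ArithCircuit.complexity_le_size (hP1.mapConsts s) rfl
    -- `2 Q' = 2 Q̄ = per − det`
    have h2 : (2 : ZMod 4) • Q' = (2 : ZMod 4) • O₄ n := by
      rw [← sub_eq_zero, ← smul_sub]
      refine two_smul_eq_zero_of_map_castHom_eq_zero _ ?_
      rw [map_sub, hQ'red, hOQ, sub_self]
    have hper : perPoly (Fin n) (ZMod 4) = detPoly (Fin n) (ZMod 4) + (2 : ZMod 4) • Q' := by
      rw [h2, hO₄]
      simp only
      rw [oddPerm_sum_eq, ← perPoly_sub_detPoly_eq]
      ring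
    rw [hper]
    refine (complexity_add_le_holds _ _).trans ?_
    exact Nat.add_le_add_right (Nat.add_le_add_left
      ((complexity_smul_le_holds _ _).trans (Nat.add_le_add_right hQ'cx 1)) _) 1
  -- p-boundedness
  have hdet : IsPBounded fun n => complexity (detPoly (Fin n) (ZMod 4)) :=
    (isVPFamily_detPoly_of_commRing (ZMod 4)).2
  refine IsPBounded.mono (IsPBounded.add_holds (IsPBounded.add_holds hdet
    (IsPBounded.add_holds hQ (IsPBounded.const 1))) (IsPBounded.const 1)) fun n => ?_
  exact hpt n

end Summit.ValiantsHypothesis.ValiantsHypothesis.Theorems.TwoAdicLadder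

end
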